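import Literature.AlgebraicGeometry.HodgeTheory.AppellHumbertFormOfPhiPic      -- ★ (J) `AbelianVariety.intGram_form_eq_nsmul_of_phiPic_cechClass_eq_pow`, `cechClass_nsmul`, `cechClass_neg_eq_inv`
import Literature.AlgebraicGeometry.Motives.GAGAKaehlerImmersionProofs          -- ★ `GeneratingSections.affineChartData`
import HarnessLib

/-!
# The hyperplane divisor of a fibre of `L^Δ(λ)`: integer Gram `= 2q •` that of `Θ`, class `= [L^Δ]^q`

Topic `AlgebraicGeometry/HodgeTheory`, namespace `Literature.AlgebraicGeometry.HodgeTheory`. KERNEL ONLY: theorems; no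
definition, no named fact, no instance, no `sorry`. Cell `hodgecm-mathlib`, (U)-lane node U-e P4, N3-core socket (R)
`Ue_N3asm_pairReading`, leaf **(F-alg)** = the ALGEBRAIC per-fibre half (P4 lead B-p03 (g14), cut 2026-08-29T16:22:57Z):
the junction between

* the fibre class `c = [L^Δ(λ)_y] ∈ Ȟ¹(A, 𝒪_A^×)` of the universal Mumford bundle with `φ_c = φ_Θ²`
  ([MumfordFogartyKirwan1994] Ch. 6 §2 Prop. 6.10, ★ T1 `phiPic_detClass_restrict_LDelta`), written `c = [𝒪(D)]` for a
  Cartier divisor `D` ((A2-tr)),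
* a closed immersion `ψ : A ↪ ℙᴷ_ℂ` with `q • D ∼ H_ψ`, `H_ψ = div(ψ^* x_a)` the hyperplane divisor ((K3), ★
  `CartierDivisor.IsAmple.exists_common_pos_smul_linEquiv_hyperplaneDivisor_le`; [Hartshorne1977] II Thm. 7.6), and
* the Appell–Humbert data `(H, χ)`, `(H′, χ′)` of `𝒪(Θ)^an`, `𝒪(H_ψ)^an` on the uniformising torus
  ([Lange2023AbelianVarietiesComplex] §1.3 Thm. 1.3.3, §1.4.2 Prop. 1.4.6 (b); [MumfordAV1970] §8).

What is proved, for a complex abelian variety `A` uniformised by `φ : ℂ^g/Φ(ℤ^{2g}) → A(ℂ)` compatible with the group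
laws:

* `AbelianVariety.cechClass_hyperplaneDivisor_eq_pow` — `[𝒪(H_ψ)] = c ^ q` in `Ȟ¹(A, 𝒪_A^×)`;
* `AbelianVariety.phiPic_hyperplaneDivisor_eq_pow` — `φ_{[𝒪(H_ψ)]}(x) = φ_{[𝒪(Θ)]}(x)^{2q}` for every `x ∈ A(ℂ)`;
* **`AbelianVariety.intGram_hyperplaneDivisor_eq_nsmul`** — (i) `intGram Φ H′ = (2q) • intGram Φ H` (★ (J)
  `AbelianVariety.intGram_form_eq_nsmul_of_phiPic_cechClass_eq_pow` with `n := 2q`);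
* **`AbelianVariety.mk_neg_hyperplaneDivisor_toUnitCocycle_eq`** — (ii) `[(−H_ψ).toUnitCocycle] = (c ^ q)⁻¹` in
  `Ȟ¹(A, 𝒪_A^×)` (★ `cechClass_eq_mk`, ★ `cechClass_neg_eq_inv`) — the representative read by the topological side
  ((T2½)-(D) `coreEulerClass_eq_smul_chernCharacter_pullback_of_deRham_eq_smul`).

The model space is `Fin g → ℂ` with lattice index `Fin g ⊕ Fin g` for an ARBITRARY `g` (the shape carried by the
N3-core sockets; `A.dim = g` is recovered inside the proofs from `IsAnalytification.finrank_eq`).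

## References

* [MumfordFogartyKirwan1994] D. Mumford, J. Fogarty, F. Kirwan, *Geometric Invariant Theory*, 3rd ed. (1994), Ch. 6 §2
  Prop. 6.10 (p. 121).
* [Lange2023AbelianVarietiesComplex] H. Lange, *Abelian Varieties over the Complex Numbers* (2023), §1.3.1 Thm. 1.3.3
  (pp. 28–30), §1.4.2 Prop. 1.4.6 (b) (p. 38).
* [MumfordAV1970] D. Mumford, *Abelian Varieties* (1970), §8 (`φ_L`, (iv) ⇒ (i)), pp. 74–80.
* [Hartshorne1977] R. Hartshorne, *Algebraic Geometry* (1977), II Thm. 7.6 (p. 154).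
* [GortzWedhorn2020] U. Görtz, T. Wedhorn, *Algebraic Geometry I*, 2nd ed. (2020), Prop. 11.21 (p. 302).

#harness_tags algebraic_geometry.abelian_varieties, hodge_theory.polarizations
-/

set_option autoImplicit false

noncomputable section

open Set Function CategoryTheory AlgebraicGeometry
open Literature.AlgebraicGeometry.Motives Literature.AlgebraicGeometry.Motives.RatFn
open Literature.Geometry.Kaehler Literature.Geometry.Kaehler.ComplexTorus
open Literature.NumberTheory.Transcendental
open Literature.AlgebraicGeometry.AbelianVarieties Literature.AlgebraicGeometry.Modules

namespace Literature.AlgebraicGeometry.HodgeTheory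

/-! ### §1 The class of the hyperplane divisor: `[𝒪(H_ψ)] = c^q`, `φ_{[𝒪(H_ψ)]} = φ_Θ^{2q}`, `[(−H_ψ)] = (c^q)⁻¹` -/

section Classes

variable (A : AbelianVariety ℂ) {Θ : CartierDivisor A.X.left} {c : CechPic A.X.left}
  {D : CartierDivisor A.X.left} {q K : ℕ} (ψ : A.X ⟶ projectiveSpace K ℂ) {a : Fin (K + 1)}
  {ha : genericPoint A.X.left ∈ (GeneratingSections.affineChartData ψ).U a}

/-- **`[𝒪_A(H_ψ)] = c ^ q` in `Ȟ¹(A, 𝒪_A^×)`** for `c = [𝒪_A(D)]` and `q • D ∼ H_ψ` (★ `cechClass_eq_iff_linEquiv`,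
★ `cechClass_nsmul`). [cite: GortzWedhorn2020, Prop. 11.21 (p. 302)] [cite: Hartshorne1977, II Thm. 7.6 (p. 154)] -/
theorem AbelianVariety.cechClass_hyperplaneDivisor_eq_pow (hD : c = D.cechClass)
    (hK3 : (q • D).LinEquiv ((GeneratingSections.affineChartData ψ).divisor a ha)) :
    ((GeneratingSections.affineChartData ψ).divisor a ha).cechClass = c ^ q := by
  rw [← (CartierDivisor.cechClass_eq_iff_linEquiv _ _).2 hK3, CartierDivisor.cechClass_nsmul, hD]

/-- **`φ_{[𝒪_A(H_ψ)]}(x) = φ_{[𝒪_A(Θ)]}(x)^{2q}`** on `A(ℂ)`: `φ` is a homomorphism in the bundle (★ `phiPicAt`, Lange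
Prop. 1.4.6 (b)), `[𝒪(H_ψ)] = c^q` and `φ_c = φ_Θ²` (MFK Prop. 6.10 for `c = [L^Δ(λ)_y]`).
[cite: Lange2023AbelianVarietiesComplex, §1.4.2 Prop. 1.4.6 (b) (p. 38)] [cite: MumfordFogartyKirwan1994, Ch. 6 §2 Prop. 6.10 (p. 121)] -/
theorem AbelianVariety.phiPic_hyperplaneDivisor_eq_pow (hc : ∀ x : A.Points ℂ, phiPic A c x = phiPic A Θ.cechClass x ^ 2)
    (hD : c = D.cechClass) (hK3 : (q • D).LinEquiv ((GeneratingSections.affineChartData ψ).divisor a ha))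
    (x : A.Points ℂ) :
    phiPic A ((GeneratingSections.affineChartData ψ).divisor a ha).cechClass x = phiPic A Θ.cechClass x ^ (2 * q) := by
  rw [AbelianVariety.cechClass_hyperplaneDivisor_eq_pow A ψ hD hK3, ← phiPicAt_apply, map_pow, phiPicAt_apply, hc,
    ← pow_mul]

/-- **(F-alg) (ii): `[𝒪_A(−H_ψ)] = (c ^ q)⁻¹` in `Ȟ¹(A, 𝒪_A^×)`**, with the LEFT side written as the class of the unit
cocycle of `−H_ψ` (★ `cechClass_eq_mk`) — the representative read by the topological Euler class of `𝒪(−1)|_A` along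
`ψ`. [cite: GortzWedhorn2020, Prop. 11.21 (p. 302)] [cite: MumfordAV1970, §8 (the group of divisor classes)] -/
theorem AbelianVariety.mk_neg_hyperplaneDivisor_toUnitCocycle_eq (hD : c = D.cechClass)
    (hK3 : (q • D).LinEquiv ((GeneratingSections.affineChartData ψ).divisor a ha)) :
    CechPic.mk (-(GeneratingSections.affineChartData ψ).divisor a ha).toUnitCocycle = (c ^ q)⁻¹ := by
  rw [← CartierDivisor.cechClass_eq_mk, AbelianVariety.cechClass_neg_eq_inv,
    AbelianVariety.cechClass_hyperplaneDivisor_eq_pow A ψ hD hK3]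

end Classes

/-! ### §2 (F-alg) (i): the integer Gram matrix of `𝒪(H_ψ)^an` is `2q •` that of `𝒪(Θ)^an` -/

section Gram

variable (A : AbelianVariety ℂ) {g : ℕ} {Φ : (Fin g ⊕ Fin g → ℝ) ≃L[ℝ] (Fin g → ℂ)}
  {φ : ComplexTorus Φ → ComplexPoints A.X} (hφ : IsAnalytification (Fin g → ℂ) A.X A.dim φ)
  (hadd : ∀ x y, φ (x + y) = φ x * φ y)
  {Θ : CartierDivisor A.X.left} {c : CechPic A.X.left} {D : CartierDivisor A.X.left} {q K : ℕ}
  (ψ : A.X ⟶ projectiveSpace K ℂ) {a : Fin (K + 1)}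
  {ha : genericPoint A.X.left ∈ (GeneratingSections.affineChartData ψ).U a}

include hadd

/-- **(F-alg) (i): `intGram Φ H′ = (2q) • intGram Φ H`.** On a complex abelian variety `A` uniformised by
`φ : ℂ^g/Φ(ℤ^{2g}) → A(ℂ)` (compatible with the group laws), let `c = [𝒪(D)] ∈ Ȟ¹(A, 𝒪^×)` satisfy `φ_c = φ_Θ²` on
`A(ℂ)` (the fibre class of `L^Δ(λ)`, MFK Prop. 6.10), let `ψ : A ⟶ ℙᴷ_ℂ` with `q • D ∼ H_ψ` (Hartshorne II 7.6),
and let `(H, χ)`, `(H′, χ′)` be Appell–Humbert data of `𝒪(Θ)^an`, `𝒪(H_ψ)^an`. Then the integer Gram matrices of the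
Riemann forms satisfy `intGram Φ H′ = (2q) • intGram Φ H` (★ (J): an algebraic `φ`-identity fixes the Appell–Humbert
form, Lange Prop. 1.4.6 (b) + Thm. 1.3.3 + Mumford §8 (iv) ⇒ (i)). The model is `Fin g → ℂ` for any `g`; `A.dim = g`
by `IsAnalytification.finrank_eq`. [cite: Lange2023AbelianVarietiesComplex, §1.4.2 Prop. 1.4.6 (b) (p. 38) and §1.3.1 Thm. 1.3.3]
[cite: MumfordAV1970, §8 ((iv) ⇒ (i))] [cite: MumfordFogartyKirwan1994, Ch. 6 §2 Prop. 6.10 (p. 121)] -/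
theorem AbelianVariety.intGram_hyperplaneDivisor_eq_nsmul
    (hc : ∀ x : A.Points ℂ, phiPic A c x = phiPic A Θ.cechClass x ^ 2) (hD : c = D.cechClass)
    (hK3 : (q • D).LinEquiv ((GeneratingSections.affineChartData ψ).divisor a ha)) (p p' : AHData Φ)
    (hp : AHData.toPic p = picClass (cartierDivisorLineBundle hφ Θ))
    (hp' : AHData.toPic p' = picClass (cartierDivisorLineBundle hφ ((GeneratingSections.affineChartData ψ).divisor a ha))) :
    intGram Φ p'.form = (2 * q) • intGram Φ p.form := by
  -- `A.dim = g`: the model `ℂ^g` has complex dimension `A.dim`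
  obtain rfl : g = A.dim := by
    have h := hφ.finrank_eq
    rwa [Module.finrank_fin_fun] at h
  exact AbelianVariety.intGram_form_eq_nsmul_of_phiPic_cechClass_eq_pow A hφ hadd Θ _ (2 * q)
    (AbelianVariety.phiPic_hyperplaneDivisor_eq_pow A ψ hc hD hK3) p p' hp hp'

end Gram

end Literature.AlgebraicGeometry.HodgeTheory

end
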